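import Summits.CriticalPhenomena.PercolationContinuityZ3.Theorems.Transplant.FKConnectivityAllQPat3RingTsymData2
import HarnessLib

/-!
# Connectivity correlation inequalities for `φ_{w,q}`, every `q > 0` — THEOREM SP DATA: the RING certificate for `tsym2Tab`,
# part 3 of 3 (Stage S2 data file; 231 products, denominator 64; 125 row-sized kernel evaluations over three files)

Theorems + data file (`--supports stmt-CriticalPhenomena-4575`), census lane `prim-bschramm-census` (gen 36) of the post-continuity programme (LANE 2 bschramm, FK sub-lane);
builds on p205010 (kernel theorem, internal audit signed; external expert review pending).
No named facts, no sorries; standard axioms (`decide +kernel` only: kernel evaluation, no compiled evaluation).  Census g34's RING certificate for the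
target `tsym2Tab` re-derived by LP in ordered pattern tables (231 products), checked by the kernel through `FK.rowG` in 125 small
declarations (rows `(P_K, Q_K, P_1)`; per-declaration memory sized for the smaller farm nodes), `FK.loop1G_of_rows`, and assembled
in part 3 by `FK.symCert_of_pairs` into **`FK.ringTsym_level_nonneg`**.
[cite: AyyerLinussonRavichandran2025, §7 eq. (13)–(15) (p. 22)] [cite: Grimmett2006, §3.8 (pp. 61–62)]
-/

noncomputable section

namespace Summit.CriticalPhenomena.PercolationContinuityZ3.Theorems

namespace FK

open SimpleGraph Literature.Probability.LatticeModels Literature.Probability.Percolation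

section Data

/- Sequential elaboration: the kernel evaluations below must not run concurrently (memory on the smaller farm nodes;
census g36 measured: 50 concurrent row evaluations are killed, sequential ones take ≈ 5 s each). -/
set_option Elab.async false

open scoped Classical

variable {V : Type*} [Fintype V]

/-! ### Row checks, part 3, and assembly -/

/-- Row `(ys_x, all, all)` of the RingTsym certificate check (kernel evaluation). [folklore] -/
theorem ringTsym_row_ys_x_all_all :
    rowG tauRingTsym 8 64 1 (prodsLRingTsym.filter fun p => suppAt p.gK Pat3.ys_x Pat3.all) Pat3.ys_x Pat3.all Pat3.all = true := by
  decide +kernel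

/-- Row `(ys_x, all, xy_s)` of the RingTsym certificate check (kernel evaluation). [folklore] -/
theorem ringTsym_row_ys_x_all_xy_s :
    rowG tauRingTsym 8 64 1 (prodsLRingTsym.filter fun p => suppAt p.gK Pat3.ys_x Pat3.all) Pat3.ys_x Pat3.all Pat3.xy_s = true := by
  decide +kernel

/-- Row `(ys_x, all, xs_y)` of the RingTsym certificate check (kernel evaluation). [folklore] -/
theorem ringTsym_row_ys_x_all_xs_y :
    rowG tauRingTsym 8 64 1 (prodsLRingTsym.filter fun p => suppAt p.gK Pat3.ys_x Pat3.all) Pat3.ys_x Pat3.all Pat3.xs_y = true := by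
  decide +kernel

/-- Row `(ys_x, all, ys_x)` of the RingTsym certificate check (kernel evaluation). [folklore] -/
theorem ringTsym_row_ys_x_all_ys_x :
    rowG tauRingTsym 8 64 1 (prodsLRingTsym.filter fun p => suppAt p.gK Pat3.ys_x Pat3.all) Pat3.ys_x Pat3.all Pat3.ys_x = true := by
  decide +kernel

/-- Row `(ys_x, all, sep)` of the RingTsym certificate check (kernel evaluation). [folklore] -/
theorem ringTsym_row_ys_x_all_sep :
    rowG tauRingTsym 8 64 1 (prodsLRingTsym.filter fun p => suppAt p.gK Pat3.ys_x Pat3.all) Pat3.ys_x Pat3.all Pat3.sep = true := by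
  decide +kernel

/-- Row `(ys_x, xy_s, all)` of the RingTsym certificate check (kernel evaluation). [folklore] -/
theorem ringTsym_row_ys_x_xy_s_all :
    rowG tauRingTsym 8 64 1 (prodsLRingTsym.filter fun p => suppAt p.gK Pat3.ys_x Pat3.xy_s) Pat3.ys_x Pat3.xy_s Pat3.all = true := by
  decide +kernel

/-- Row `(ys_x, xy_s, xy_s)` of the RingTsym certificate check (kernel evaluation). [folklore] -/
theorem ringTsym_row_ys_x_xy_s_xy_s :
    rowG tauRingTsym 8 64 1 (prodsLRingTsym.filter fun p => suppAt p.gK Pat3.ys_x Pat3.xy_s) Pat3.ys_x Pat3.xy_s Pat3.xy_s = true := by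
  decide +kernel

/-- Row `(ys_x, xy_s, xs_y)` of the RingTsym certificate check (kernel evaluation). [folklore] -/
theorem ringTsym_row_ys_x_xy_s_xs_y :
    rowG tauRingTsym 8 64 1 (prodsLRingTsym.filter fun p => suppAt p.gK Pat3.ys_x Pat3.xy_s) Pat3.ys_x Pat3.xy_s Pat3.xs_y = true := by
  decide +kernel

/-- Row `(ys_x, xy_s, ys_x)` of the RingTsym certificate check (kernel evaluation). [folklore] -/
theorem ringTsym_row_ys_x_xy_s_ys_x :
    rowG tauRingTsym 8 64 1 (prodsLRingTsym.filter fun p => suppAt p.gK Pat3.ys_x Pat3.xy_s) Pat3.ys_x Pat3.xy_s Pat3.ys_x = true := by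
  decide +kernel

/-- Row `(ys_x, xy_s, sep)` of the RingTsym certificate check (kernel evaluation). [folklore] -/
theorem ringTsym_row_ys_x_xy_s_sep :
    rowG tauRingTsym 8 64 1 (prodsLRingTsym.filter fun p => suppAt p.gK Pat3.ys_x Pat3.xy_s) Pat3.ys_x Pat3.xy_s Pat3.sep = true := by
  decide +kernel

/-- Row `(ys_x, xs_y, all)` of the RingTsym certificate check (kernel evaluation). [folklore] -/
theorem ringTsym_row_ys_x_xs_y_all :
    rowG tauRingTsym 8 64 1 (prodsLRingTsym.filter fun p => suppAt p.gK Pat3.ys_x Pat3.xs_y) Pat3.ys_x Pat3.xs_y Pat3.all = true := by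
  decide +kernel

/-- Row `(ys_x, xs_y, xy_s)` of the RingTsym certificate check (kernel evaluation). [folklore] -/
theorem ringTsym_row_ys_x_xs_y_xy_s :
    rowG tauRingTsym 8 64 1 (prodsLRingTsym.filter fun p => suppAt p.gK Pat3.ys_x Pat3.xs_y) Pat3.ys_x Pat3.xs_y Pat3.xy_s = true := by
  decide +kernel

/-- Row `(ys_x, xs_y, xs_y)` of the RingTsym certificate check (kernel evaluation). [folklore] -/
theorem ringTsym_row_ys_x_xs_y_xs_y :
    rowG tauRingTsym 8 64 1 (prodsLRingTsym.filter fun p => suppAt p.gK Pat3.ys_x Pat3.xs_y) Pat3.ys_x Pat3.xs_y Pat3.xs_y = true := by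
  decide +kernel

/-- Row `(ys_x, xs_y, ys_x)` of the RingTsym certificate check (kernel evaluation). [folklore] -/
theorem ringTsym_row_ys_x_xs_y_ys_x :
    rowG tauRingTsym 8 64 1 (prodsLRingTsym.filter fun p => suppAt p.gK Pat3.ys_x Pat3.xs_y) Pat3.ys_x Pat3.xs_y Pat3.ys_x = true := by
  decide +kernel

/-- Row `(ys_x, xs_y, sep)` of the RingTsym certificate check (kernel evaluation). [folklore] -/
theorem ringTsym_row_ys_x_xs_y_sep :
    rowG tauRingTsym 8 64 1 (prodsLRingTsym.filter fun p => suppAt p.gK Pat3.ys_x Pat3.xs_y) Pat3.ys_x Pat3.xs_y Pat3.sep = true := by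
  decide +kernel

/-- Row `(ys_x, ys_x, all)` of the RingTsym certificate check (kernel evaluation). [folklore] -/
theorem ringTsym_row_ys_x_ys_x_all :
    rowG tauRingTsym 8 64 1 (prodsLRingTsym.filter fun p => suppAt p.gK Pat3.ys_x Pat3.ys_x) Pat3.ys_x Pat3.ys_x Pat3.all = true := by
  decide +kernel

/-- Row `(ys_x, ys_x, xy_s)` of the RingTsym certificate check (kernel evaluation). [folklore] -/
theorem ringTsym_row_ys_x_ys_x_xy_s :
    rowG tauRingTsym 8 64 1 (prodsLRingTsym.filter fun p => suppAt p.gK Pat3.ys_x Pat3.ys_x) Pat3.ys_x Pat3.ys_x Pat3.xy_s = true := by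
  decide +kernel

/-- Row `(ys_x, ys_x, xs_y)` of the RingTsym certificate check (kernel evaluation). [folklore] -/
theorem ringTsym_row_ys_x_ys_x_xs_y :
    rowG tauRingTsym 8 64 1 (prodsLRingTsym.filter fun p => suppAt p.gK Pat3.ys_x Pat3.ys_x) Pat3.ys_x Pat3.ys_x Pat3.xs_y = true := by
  decide +kernel

/-- Row `(ys_x, ys_x, ys_x)` of the RingTsym certificate check (kernel evaluation). [folklore] -/
theorem ringTsym_row_ys_x_ys_x_ys_x :
    rowG tauRingTsym 8 64 1 (prodsLRingTsym.filter fun p => suppAt p.gK Pat3.ys_x Pat3.ys_x) Pat3.ys_x Pat3.ys_x Pat3.ys_x = true := by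
  decide +kernel

/-- Row `(ys_x, ys_x, sep)` of the RingTsym certificate check (kernel evaluation). [folklore] -/
theorem ringTsym_row_ys_x_ys_x_sep :
    rowG tauRingTsym 8 64 1 (prodsLRingTsym.filter fun p => suppAt p.gK Pat3.ys_x Pat3.ys_x) Pat3.ys_x Pat3.ys_x Pat3.sep = true := by
  decide +kernel

/-- Row `(ys_x, sep, all)` of the RingTsym certificate check (kernel evaluation). [folklore] -/
theorem ringTsym_row_ys_x_sep_all :
    rowG tauRingTsym 8 64 1 (prodsLRingTsym.filter fun p => suppAt p.gK Pat3.ys_x Pat3.sep) Pat3.ys_x Pat3.sep Pat3.all = true := by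
  decide +kernel

/-- Row `(ys_x, sep, xy_s)` of the RingTsym certificate check (kernel evaluation). [folklore] -/
theorem ringTsym_row_ys_x_sep_xy_s :
    rowG tauRingTsym 8 64 1 (prodsLRingTsym.filter fun p => suppAt p.gK Pat3.ys_x Pat3.sep) Pat3.ys_x Pat3.sep Pat3.xy_s = true := by
  decide +kernel

/-- Row `(ys_x, sep, xs_y)` of the RingTsym certificate check (kernel evaluation). [folklore] -/
theorem ringTsym_row_ys_x_sep_xs_y :
    rowG tauRingTsym 8 64 1 (prodsLRingTsym.filter fun p => suppAt p.gK Pat3.ys_x Pat3.sep) Pat3.ys_x Pat3.sep Pat3.xs_y = true := by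
  decide +kernel

/-- Row `(ys_x, sep, ys_x)` of the RingTsym certificate check (kernel evaluation). [folklore] -/
theorem ringTsym_row_ys_x_sep_ys_x :
    rowG tauRingTsym 8 64 1 (prodsLRingTsym.filter fun p => suppAt p.gK Pat3.ys_x Pat3.sep) Pat3.ys_x Pat3.sep Pat3.ys_x = true := by
  decide +kernel

/-- Row `(ys_x, sep, sep)` of the RingTsym certificate check (kernel evaluation). [folklore] -/
theorem ringTsym_row_ys_x_sep_sep :
    rowG tauRingTsym 8 64 1 (prodsLRingTsym.filter fun p => suppAt p.gK Pat3.ys_x Pat3.sep) Pat3.ys_x Pat3.sep Pat3.sep = true := by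
  decide +kernel

/-- Row `(sep, all, all)` of the RingTsym certificate check (kernel evaluation). [folklore] -/
theorem ringTsym_row_sep_all_all :
    rowG tauRingTsym 8 64 1 (prodsLRingTsym.filter fun p => suppAt p.gK Pat3.sep Pat3.all) Pat3.sep Pat3.all Pat3.all = true := by
  decide +kernel

/-- Row `(sep, all, xy_s)` of the RingTsym certificate check (kernel evaluation). [folklore] -/
theorem ringTsym_row_sep_all_xy_s :
    rowG tauRingTsym 8 64 1 (prodsLRingTsym.filter fun p => suppAt p.gK Pat3.sep Pat3.all) Pat3.sep Pat3.all Pat3.xy_s = true := by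
  decide +kernel

/-- Row `(sep, all, xs_y)` of the RingTsym certificate check (kernel evaluation). [folklore] -/
theorem ringTsym_row_sep_all_xs_y :
    rowG tauRingTsym 8 64 1 (prodsLRingTsym.filter fun p => suppAt p.gK Pat3.sep Pat3.all) Pat3.sep Pat3.all Pat3.xs_y = true := by
  decide +kernel

/-- Row `(sep, all, ys_x)` of the RingTsym certificate check (kernel evaluation). [folklore] -/
theorem ringTsym_row_sep_all_ys_x :
    rowG tauRingTsym 8 64 1 (prodsLRingTsym.filter fun p => suppAt p.gK Pat3.sep Pat3.all) Pat3.sep Pat3.all Pat3.ys_x = true := by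
  decide +kernel

/-- Row `(sep, all, sep)` of the RingTsym certificate check (kernel evaluation). [folklore] -/
theorem ringTsym_row_sep_all_sep :
    rowG tauRingTsym 8 64 1 (prodsLRingTsym.filter fun p => suppAt p.gK Pat3.sep Pat3.all) Pat3.sep Pat3.all Pat3.sep = true := by
  decide +kernel

/-- Row `(sep, xy_s, all)` of the RingTsym certificate check (kernel evaluation). [folklore] -/
theorem ringTsym_row_sep_xy_s_all :
    rowG tauRingTsym 8 64 1 (prodsLRingTsym.filter fun p => suppAt p.gK Pat3.sep Pat3.xy_s) Pat3.sep Pat3.xy_s Pat3.all = true := by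
  decide +kernel

/-- Row `(sep, xy_s, xy_s)` of the RingTsym certificate check (kernel evaluation). [folklore] -/
theorem ringTsym_row_sep_xy_s_xy_s :
    rowG tauRingTsym 8 64 1 (prodsLRingTsym.filter fun p => suppAt p.gK Pat3.sep Pat3.xy_s) Pat3.sep Pat3.xy_s Pat3.xy_s = true := by
  decide +kernel

/-- Row `(sep, xy_s, xs_y)` of the RingTsym certificate check (kernel evaluation). [folklore] -/
theorem ringTsym_row_sep_xy_s_xs_y :
    rowG tauRingTsym 8 64 1 (prodsLRingTsym.filter fun p => suppAt p.gK Pat3.sep Pat3.xy_s) Pat3.sep Pat3.xy_s Pat3.xs_y = true := by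
  decide +kernel

/-- Row `(sep, xy_s, ys_x)` of the RingTsym certificate check (kernel evaluation). [folklore] -/
theorem ringTsym_row_sep_xy_s_ys_x :
    rowG tauRingTsym 8 64 1 (prodsLRingTsym.filter fun p => suppAt p.gK Pat3.sep Pat3.xy_s) Pat3.sep Pat3.xy_s Pat3.ys_x = true := by
  decide +kernel

/-- Row `(sep, xy_s, sep)` of the RingTsym certificate check (kernel evaluation). [folklore] -/
theorem ringTsym_row_sep_xy_s_sep :
    rowG tauRingTsym 8 64 1 (prodsLRingTsym.filter fun p => suppAt p.gK Pat3.sep Pat3.xy_s) Pat3.sep Pat3.xy_s Pat3.sep = true := by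
  decide +kernel

/-- Row `(sep, xs_y, all)` of the RingTsym certificate check (kernel evaluation). [folklore] -/
theorem ringTsym_row_sep_xs_y_all :
    rowG tauRingTsym 8 64 1 (prodsLRingTsym.filter fun p => suppAt p.gK Pat3.sep Pat3.xs_y) Pat3.sep Pat3.xs_y Pat3.all = true := by
  decide +kernel

/-- Row `(sep, xs_y, xy_s)` of the RingTsym certificate check (kernel evaluation). [folklore] -/
theorem ringTsym_row_sep_xs_y_xy_s :
    rowG tauRingTsym 8 64 1 (prodsLRingTsym.filter fun p => suppAt p.gK Pat3.sep Pat3.xs_y) Pat3.sep Pat3.xs_y Pat3.xy_s = true := by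
  decide +kernel

/-- Row `(sep, xs_y, xs_y)` of the RingTsym certificate check (kernel evaluation). [folklore] -/
theorem ringTsym_row_sep_xs_y_xs_y :
    rowG tauRingTsym 8 64 1 (prodsLRingTsym.filter fun p => suppAt p.gK Pat3.sep Pat3.xs_y) Pat3.sep Pat3.xs_y Pat3.xs_y = true := by
  decide +kernel

/-- Row `(sep, xs_y, ys_x)` of the RingTsym certificate check (kernel evaluation). [folklore] -/
theorem ringTsym_row_sep_xs_y_ys_x :
    rowG tauRingTsym 8 64 1 (prodsLRingTsym.filter fun p => suppAt p.gK Pat3.sep Pat3.xs_y) Pat3.sep Pat3.xs_y Pat3.ys_x = true := by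
  decide +kernel

/-- Row `(sep, xs_y, sep)` of the RingTsym certificate check (kernel evaluation). [folklore] -/
theorem ringTsym_row_sep_xs_y_sep :
    rowG tauRingTsym 8 64 1 (prodsLRingTsym.filter fun p => suppAt p.gK Pat3.sep Pat3.xs_y) Pat3.sep Pat3.xs_y Pat3.sep = true := by
  decide +kernel

/-- Row `(sep, ys_x, all)` of the RingTsym certificate check (kernel evaluation). [folklore] -/
theorem ringTsym_row_sep_ys_x_all :
    rowG tauRingTsym 8 64 1 (prodsLRingTsym.filter fun p => suppAt p.gK Pat3.sep Pat3.ys_x) Pat3.sep Pat3.ys_x Pat3.all = true := by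
  decide +kernel

/-- Row `(sep, ys_x, xy_s)` of the RingTsym certificate check (kernel evaluation). [folklore] -/
theorem ringTsym_row_sep_ys_x_xy_s :
    rowG tauRingTsym 8 64 1 (prodsLRingTsym.filter fun p => suppAt p.gK Pat3.sep Pat3.ys_x) Pat3.sep Pat3.ys_x Pat3.xy_s = true := by
  decide +kernel

/-- Row `(sep, ys_x, xs_y)` of the RingTsym certificate check (kernel evaluation). [folklore] -/
theorem ringTsym_row_sep_ys_x_xs_y :
    rowG tauRingTsym 8 64 1 (prodsLRingTsym.filter fun p => suppAt p.gK Pat3.sep Pat3.ys_x) Pat3.sep Pat3.ys_x Pat3.xs_y = true := by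
  decide +kernel

/-- Row `(sep, ys_x, ys_x)` of the RingTsym certificate check (kernel evaluation). [folklore] -/
theorem ringTsym_row_sep_ys_x_ys_x :
    rowG tauRingTsym 8 64 1 (prodsLRingTsym.filter fun p => suppAt p.gK Pat3.sep Pat3.ys_x) Pat3.sep Pat3.ys_x Pat3.ys_x = true := by
  decide +kernel

/-- Row `(sep, ys_x, sep)` of the RingTsym certificate check (kernel evaluation). [folklore] -/
theorem ringTsym_row_sep_ys_x_sep :
    rowG tauRingTsym 8 64 1 (prodsLRingTsym.filter fun p => suppAt p.gK Pat3.sep Pat3.ys_x) Pat3.sep Pat3.ys_x Pat3.sep = true := by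
  decide +kernel

/-- Row `(sep, sep, all)` of the RingTsym certificate check (kernel evaluation). [folklore] -/
theorem ringTsym_row_sep_sep_all :
    rowG tauRingTsym 8 64 1 (prodsLRingTsym.filter fun p => suppAt p.gK Pat3.sep Pat3.sep) Pat3.sep Pat3.sep Pat3.all = true := by
  decide +kernel

/-- Row `(sep, sep, xy_s)` of the RingTsym certificate check (kernel evaluation). [folklore] -/
theorem ringTsym_row_sep_sep_xy_s :
    rowG tauRingTsym 8 64 1 (prodsLRingTsym.filter fun p => suppAt p.gK Pat3.sep Pat3.sep) Pat3.sep Pat3.sep Pat3.xy_s = true := by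
  decide +kernel

/-- Row `(sep, sep, xs_y)` of the RingTsym certificate check (kernel evaluation). [folklore] -/
theorem ringTsym_row_sep_sep_xs_y :
    rowG tauRingTsym 8 64 1 (prodsLRingTsym.filter fun p => suppAt p.gK Pat3.sep Pat3.sep) Pat3.sep Pat3.sep Pat3.xs_y = true := by
  decide +kernel

/-- Row `(sep, sep, ys_x)` of the RingTsym certificate check (kernel evaluation). [folklore] -/
theorem ringTsym_row_sep_sep_ys_x :
    rowG tauRingTsym 8 64 1 (prodsLRingTsym.filter fun p => suppAt p.gK Pat3.sep Pat3.sep) Pat3.sep Pat3.sep Pat3.ys_x = true := by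
  decide +kernel

/-- Row `(sep, sep, sep)` of the RingTsym certificate check (kernel evaluation). [folklore] -/
theorem ringTsym_row_sep_sep_sep :
    rowG tauRingTsym 8 64 1 (prodsLRingTsym.filter fun p => suppAt p.gK Pat3.sep Pat3.sep) Pat3.sep Pat3.sep Pat3.sep = true := by
  decide +kernel

/-- Pair `(ys_x, all)` of the RingTsym certificate check, from its five rows. [folklore] -/
theorem ringTsym_pair_ys_x_all : loop1G tauRingTsym 8 64 1 (prodsLRingTsym.filter fun p => suppAt p.gK Pat3.ys_x Pat3.all) Pat3.ys_x Pat3.all = true :=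
  loop1G_of_rows fun R => by
    cases R; exacts [ringTsym_row_ys_x_all_all, ringTsym_row_ys_x_all_xy_s, ringTsym_row_ys_x_all_xs_y, ringTsym_row_ys_x_all_ys_x, ringTsym_row_ys_x_all_sep]

/-- Pair `(ys_x, xy_s)` of the RingTsym certificate check, from its five rows. [folklore] -/
theorem ringTsym_pair_ys_x_xy_s : loop1G tauRingTsym 8 64 1 (prodsLRingTsym.filter fun p => suppAt p.gK Pat3.ys_x Pat3.xy_s) Pat3.ys_x Pat3.xy_s = true :=
  loop1G_of_rows fun R => by
    cases R; exacts [ringTsym_row_ys_x_xy_s_all, ringTsym_row_ys_x_xy_s_xy_s, ringTsym_row_ys_x_xy_s_xs_y, ringTsym_row_ys_x_xy_s_ys_x, ringTsym_row_ys_x_xy_s_sep]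

/-- Pair `(ys_x, xs_y)` of the RingTsym certificate check, from its five rows. [folklore] -/
theorem ringTsym_pair_ys_x_xs_y : loop1G tauRingTsym 8 64 1 (prodsLRingTsym.filter fun p => suppAt p.gK Pat3.ys_x Pat3.xs_y) Pat3.ys_x Pat3.xs_y = true :=
  loop1G_of_rows fun R => by
    cases R; exacts [ringTsym_row_ys_x_xs_y_all, ringTsym_row_ys_x_xs_y_xy_s, ringTsym_row_ys_x_xs_y_xs_y, ringTsym_row_ys_x_xs_y_ys_x, ringTsym_row_ys_x_xs_y_sep]

/-- Pair `(ys_x, ys_x)` of the RingTsym certificate check, from its five rows. [folklore] -/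
theorem ringTsym_pair_ys_x_ys_x : loop1G tauRingTsym 8 64 1 (prodsLRingTsym.filter fun p => suppAt p.gK Pat3.ys_x Pat3.ys_x) Pat3.ys_x Pat3.ys_x = true :=
  loop1G_of_rows fun R => by
    cases R; exacts [ringTsym_row_ys_x_ys_x_all, ringTsym_row_ys_x_ys_x_xy_s, ringTsym_row_ys_x_ys_x_xs_y, ringTsym_row_ys_x_ys_x_ys_x, ringTsym_row_ys_x_ys_x_sep]

/-- Pair `(ys_x, sep)` of the RingTsym certificate check, from its five rows. [folklore] -/
theorem ringTsym_pair_ys_x_sep : loop1G tauRingTsym 8 64 1 (prodsLRingTsym.filter fun p => suppAt p.gK Pat3.ys_x Pat3.sep) Pat3.ys_x Pat3.sep = true :=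
  loop1G_of_rows fun R => by
    cases R; exacts [ringTsym_row_ys_x_sep_all, ringTsym_row_ys_x_sep_xy_s, ringTsym_row_ys_x_sep_xs_y, ringTsym_row_ys_x_sep_ys_x, ringTsym_row_ys_x_sep_sep]

/-- Pair `(sep, all)` of the RingTsym certificate check, from its five rows. [folklore] -/
theorem ringTsym_pair_sep_all : loop1G tauRingTsym 8 64 1 (prodsLRingTsym.filter fun p => suppAt p.gK Pat3.sep Pat3.all) Pat3.sep Pat3.all = true :=
  loop1G_of_rows fun R => by
    cases R; exacts [ringTsym_row_sep_all_all, ringTsym_row_sep_all_xy_s, ringTsym_row_sep_all_xs_y, ringTsym_row_sep_all_ys_x, ringTsym_row_sep_all_sep]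

/-- Pair `(sep, xy_s)` of the RingTsym certificate check, from its five rows. [folklore] -/
theorem ringTsym_pair_sep_xy_s : loop1G tauRingTsym 8 64 1 (prodsLRingTsym.filter fun p => suppAt p.gK Pat3.sep Pat3.xy_s) Pat3.sep Pat3.xy_s = true :=
  loop1G_of_rows fun R => by
    cases R; exacts [ringTsym_row_sep_xy_s_all, ringTsym_row_sep_xy_s_xy_s, ringTsym_row_sep_xy_s_xs_y, ringTsym_row_sep_xy_s_ys_x, ringTsym_row_sep_xy_s_sep]

/-- Pair `(sep, xs_y)` of the RingTsym certificate check, from its five rows. [folklore] -/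
theorem ringTsym_pair_sep_xs_y : loop1G tauRingTsym 8 64 1 (prodsLRingTsym.filter fun p => suppAt p.gK Pat3.sep Pat3.xs_y) Pat3.sep Pat3.xs_y = true :=
  loop1G_of_rows fun R => by
    cases R; exacts [ringTsym_row_sep_xs_y_all, ringTsym_row_sep_xs_y_xy_s, ringTsym_row_sep_xs_y_xs_y, ringTsym_row_sep_xs_y_ys_x, ringTsym_row_sep_xs_y_sep]

/-- Pair `(sep, ys_x)` of the RingTsym certificate check, from its five rows. [folklore] -/
theorem ringTsym_pair_sep_ys_x : loop1G tauRingTsym 8 64 1 (prodsLRingTsym.filter fun p => suppAt p.gK Pat3.sep Pat3.ys_x) Pat3.sep Pat3.ys_x = true :=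
  loop1G_of_rows fun R => by
    cases R; exacts [ringTsym_row_sep_ys_x_all, ringTsym_row_sep_ys_x_xy_s, ringTsym_row_sep_ys_x_xs_y, ringTsym_row_sep_ys_x_ys_x, ringTsym_row_sep_ys_x_sep]

/-- Pair `(sep, sep)` of the RingTsym certificate check, from its five rows. [folklore] -/
theorem ringTsym_pair_sep_sep : loop1G tauRingTsym 8 64 1 (prodsLRingTsym.filter fun p => suppAt p.gK Pat3.sep Pat3.sep) Pat3.sep Pat3.sep = true :=
  loop1G_of_rows fun R => by
    cases R; exacts [ringTsym_row_sep_sep_all, ringTsym_row_sep_sep_xy_s, ringTsym_row_sep_sep_xs_y, ringTsym_row_sep_sep_ys_x, ringTsym_row_sep_sep_sep]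

/-- **The symmetrised certificate family** `8 · Σ_j λ_j π_j ≤ 64 · target3Sym joinRing corrRing tsym2Tab` at every level offset and cell. [folklore] -/
theorem ringTsym_cert (d : ℕ) (PK QK P1 Q1 P2 Q2 : Pat3) :
    8 * ∑ j : Fin (prodsRingTsym.map Prod3G.toProd3).length,
        (((prodsRingTsym.map Prod3G.toProd3).get j).lam : ℤ) *
          ((prodsRingTsym.map Prod3G.toProd3).get j).tensor d PK QK P1 Q1 P2 Q2 ≤
      (64 : ℕ) * target3Sym joinRing corrRing tsym2Tab d PK QK P1 Q1 P2 Q2 :=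
  symCert_of_pairs corrRing_le_two 64 1 ringTsym_shift (fun PK QK => by
    cases PK <;> cases QK
    exacts [ringTsym_pair_all_all, ringTsym_pair_all_xy_s, ringTsym_pair_all_xs_y, ringTsym_pair_all_ys_x, ringTsym_pair_all_sep,
      ringTsym_pair_xy_s_all, ringTsym_pair_xy_s_xy_s, ringTsym_pair_xy_s_xs_y, ringTsym_pair_xy_s_ys_x, ringTsym_pair_xy_s_sep,
      ringTsym_pair_xs_y_all, ringTsym_pair_xs_y_xy_s, ringTsym_pair_xs_y_xs_y, ringTsym_pair_xs_y_ys_x, ringTsym_pair_xs_y_sep,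
      ringTsym_pair_ys_x_all, ringTsym_pair_ys_x_xy_s, ringTsym_pair_ys_x_xs_y, ringTsym_pair_ys_x_ys_x, ringTsym_pair_ys_x_sep,
      ringTsym_pair_sep_all, ringTsym_pair_sep_xy_s, ringTsym_pair_sep_xs_y, ringTsym_pair_sep_ys_x, ringTsym_pair_sep_sep]) d PK QK P1 Q1 P2 Q2

/-- **THEOREM SP (RING, target `tsym2Tab`; census g34, kernel):** for three two-terminal series–parallel pieces in a ring `K(v,u;b)·Q₁(u,w;s)·Q₂(w,v;t)` (RING), each piece two-terminal
series–parallel between its corners with its mark inner, `0 ≤ 64 · lev2 (E_K ∪ E₁ ∪ E₂) b s t tsym2Tab λ` at EVERY level `λ`.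
[cite: AyyerLinussonRavichandran2025, §7 (p. 22)] -/
theorem ringTsym_level_nonneg {EK E₁ E₂ : Finset (Sym2 V)} {VK V₁ V₂ : Set V} {u v w b s t : V}
    (hdK1 : Disjoint EK E₁) (hdK2 : Disjoint EK E₂) (hd12 : Disjoint E₁ E₂)
    (hK : ∀ e ∈ (↑EK : Set (Sym2 V)), ∀ z ∈ e, z ∈ VK)
    (h₁ : ∀ e ∈ (↑E₁ : Set (Sym2 V)), ∀ z ∈ e, z ∈ V₁) (h₂ : ∀ e ∈ (↑E₂ : Set (Sym2 V)), ∀ z ∈ e, z ∈ V₂)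
    (hK1 : VK ∩ V₁ ⊆ ({u} : Set V)) (h12 : V₁ ∩ V₂ ⊆ ({w} : Set V)) (hK2 : VK ∩ V₂ ⊆ ({v} : Set V))
    (hu2 : u ∉ V₂) (hv1 : v ∉ V₁) (huv : u ≠ v) (huw : u ≠ w) (hvw : v ≠ w)
    (hb1 : b ∉ V₁) (hb2 : b ∉ V₂) (hsK : s ∉ VK) (hs2 : s ∉ V₂) (htK : t ∉ VK) (ht1 : t ∉ V₁)
    (hbu : b ≠ u) (hbv : b ≠ v) (hsu : s ≠ u) (hsv : s ≠ v) (hsw : s ≠ w) (htu : t ≠ u) (htv : t ≠ v) (htw : t ≠ w)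
    (hbs : b ≠ s) (hbt : b ≠ t) (hst : s ≠ t)
    (hKsp : IsTTSP EK v u) (h1sp : IsTTSP E₁ u w) (h2sp : IsTTSP E₂ w v)
    (hbK : ∃ e ∈ EK, b ∈ e) (hs1 : ∃ e ∈ E₁, s ∈ e) (ht2 : ∃ e ∈ E₂, t ∈ e)
    (lam : ℕ) : 0 ≤ ((64 : ℕ) : ℤ) * lev2 (EK ∪ E₁ ∪ E₂) b s t tsym2Tab lam :=
  ring_level_nonneg_of_symCertG hdK1 hdK2 hd12 hK h₁ h₂ hK1 h12 hK2 hu2 hv1 huv huw hvw hb1 hb2 hsK hs2 htK ht1 hbu hbv hsu hsv hsw htu htv htw hbs hbt hst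
    hKsp h1sp h2sp hbK hs1 ht2 tsym2Tab 64 prodsRingTsym ringTsym_ok ringTsym_cert lam

end Data

end FK

end Summit.CriticalPhenomena.PercolationContinuityZ3.Theorems

end
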